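import Mathlib.RingTheory.OrderOfVanishing.Basic
import Mathlib.RingTheory.DiscreteValuationRing.Basic
import Mathlib.RingTheory.Length
import Mathlib.LinearAlgebra.Isomorphisms
import Literature.Algebra.Module.DVRModuleType
import Literature.Algebra.Module.CyclicModuleSubmodules
import Literature.Algebra.Module.PIDInvariantFactors
import Literature.Algebra.Module.HomModulesElementaryProperties
import HarnessLib

/-!
# `Hom`-counting for torsion modules over a discrete valuation ring: `ℓ(Hom_R(X, P)) ≤ ℓ(X)`, cyclic
# `ϖ`-torsion, and `P ⊇ R/(ϖᵏ)` as a cogenerator (the counting behind Howard 2004, Lemma 1.5.6)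

Topic `Algebra/Module`; namespace `Literature.Algebra.Module` (sequel to `SymplecticTorsionModulesDVR.lean`,
`PairedTorsionModulesDVR.lean`, `CyclicModuleSubmodules.lean`, `HomModulesElementaryProperties.lean`;
continued in `TorsionPairingDualityDVR.lean`). THEOREMS ONLY: no definition, no named fact, no instance,
no `sorry`. Cell `pub/bsd-print-x9`, print leaf G87
`Literature.NumberTheory.GaloisCohomology.Howard2004.thm161_dvrKolyvaginBound` (Howard 2004 Thm. 1.6.1): after
the 2026-08-29 kernel reduction the leaf rests on Howard's Prop. 1.4.1 and Lemma 1.6.4; Lemma 1.6.4 is proved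
from §1.5, whose module-theoretic content (Lemmas 1.5.6–1.5.8, Prop. 1.5.9) is linear algebra over the
principal Artinian ring `R/(ϖᵏ)` for a perfect pairing between two free rank-two modules («`H¹_f(K_λ,T)` and
`H¹_tr(K_λ,T)` are free rank two `R`-modules», arXiv p0009 L105–108). This file supplies the COUNTING used
there («The sum of the lengths of `A` and `A^⊥` must be `4k·ν(m)`», Lemma 1.5.6, arXiv p0010 L101): lengths
of `Hom_R(X, P)` for `ϖᵏ`-torsion `X`, in the `P`-with-cyclic-`ϖ`-torsion convention of the sequels.

SOURCE. B. Howard, *The Heegner point Kolyvagin system*, Compositio Math. **140** (2004) 1439–1472, §1.5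
(= arXiv:1202.6340 §2.5, held text p0010 L80–L102, Lemma 2.5.6 and its proof). Classical module theory:
[Kaplansky1954] §11 (lengths of `ϖ`-primary modules, `ℓ(R/(ϖⁿ)) = n`), [Fuchs1970] §43 (`Hom(R/(r), C) ≅ C[r]`,
`Hom(⊕ Aᵢ, C) ≅ Π Hom(Aᵢ, C)`).

WHAT IS PROVED (`R` a DVR with uniformiser `ϖ`, `hϖ : Irreducible ϖ`; `P` an `R`-module whose `ϖ`-torsion is
cyclic, `hP : ∀ p q, ϖp = 0 → ϖq = 0 → p ≠ 0 → ∃ r, q = r p`, e.g. `P = R/(ϖᵏ)`):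
* §0 bookkeeping (any ring): `length_eq_length_submodule_add_length_quotient`, the modular law
  `length_sup_add_length_inf` (`ℓ(S + T) + ℓ(S ∩ T) = ℓ(S) + ℓ(T)`), `eq_top_of_length_eq_of_ne_top`
  (for `N ≤ N'` of equal finite length use the tree's `Literature.RingTheory.DiscreteValuationRing.eq_of_le_of_length_eq`).
* §1 `length_quotient_uniformizer_pow` (`ℓ(R/(ϖⁿ)) = n`), `uniformizer_pow_smul_quotient_eq_zero`,
  `uniformizer_pow_smul_eq_zero_of_linearEquiv`, `span_singleton_uniformizer_torsion_cyclic` (the `ϖ`-torsion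
  of a cyclic module `R∙x` is cyclic), `length_torsionBy_le_one`, `length_torsionBy_pow_le` (`ℓ(P[ϖⁿ]) ≤ n`),
  **`length_linearMap_le`** (`ℓ(Hom_R(X, P)) ≤ ℓ(X)` for `X` finitely generated with `ϖᵏX = 0`:
  `X ≅ Π R/(ϖ^{nᵢ})`, `Hom(R/(ϖⁿ), P) ≅ P[ϖⁿ]`; equality holds when `P ⊇ R/(ϖᵏ)` — Matlis duality — but only
  the inequality is used), **`exists_linearMap_apply_ne_zero`** (if `P` contains an element of exact order
  `ϖᵏ` then `P` cogenerates the finitely generated `ϖᵏ`-torsion modules: `x ≠ 0 ⟹ ∃ φ : X → P, φ x ≠ 0`).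

NOT HERE: pairings (sequel), anything Galois-cohomological; `thm161_dvrKolyvaginBound` is NOT proved by this
file.
-/

noncomputable section

open Module Submodule
open scoped Pointwise

namespace Literature.Algebra.Module

universe u v w

/-! ### §0 Length bookkeeping (any ring) -/

section Bookkeeping

variable {R : Type*} [Ring R] {M : Type*} [AddCommGroup M] [Module R M]

/-- `ℓ(M) = ℓ(N) + ℓ(M/N)` for a submodule `N ≤ M` (additivity of length on `0 → N → M → M/N → 0`).
[cite: Kaplansky1954, §11 (PDF p. 29)] -/
theorem length_eq_length_submodule_add_length_quotient (N : Submodule R M) :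
    Module.length R M = Module.length R N + Module.length R (M ⧸ N) :=
  Module.length_eq_add_of_exact N.subtype N.mkQ N.injective_subtype N.mkQ_surjective
    (LinearMap.exact_subtype_mkQ N)

/-- **Modular law for lengths**: `ℓ(S + T) + ℓ(S ∩ T) = ℓ(S) + ℓ(T)` (second isomorphism theorem
`S/(S ∩ T) ≅ (S + T)/T`). [cite: Kaplansky1954, §11 (PDF p. 29)] -/
theorem length_sup_add_length_inf (S T : Submodule R M) :
    Module.length R ↥(S ⊔ T) + Module.length R ↥(S ⊓ T) =
      Module.length R S + Module.length R T := by
  have h1 := length_eq_length_submodule_add_length_quotient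
    (comap S.subtype S ⊓ comap S.subtype T)
  have h2 := length_eq_length_submodule_add_length_quotient (comap (S ⊔ T).subtype T)
  have e1 : Module.length R ↥(comap S.subtype S ⊓ comap S.subtype T) = Module.length R ↥(S ⊓ T) := by
    rw [← Submodule.comap_inf]
    exact (Submodule.comapSubtypeEquivOfLe (inf_le_left : S ⊓ T ≤ S)).length_eq
  have e2 : Module.length R ↥(comap (S ⊔ T).subtype T) = Module.length R T :=
    (Submodule.comapSubtypeEquivOfLe (le_sup_right : T ≤ S ⊔ T)).length_eq
  have e3 := (LinearMap.quotientInfEquivSupQuotient S T).length_eq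
  rw [e1, e3] at h1
  rw [e2] at h2
  rw [h1, h2]
  ring

/-- A submodule of full (finite) length is the whole module. [cite: Kaplansky1954, §11 (PDF p. 29)] -/
theorem eq_top_of_length_eq_of_ne_top {N : Submodule R M} (hM : Module.length R M ≠ ⊤)
    (h : Module.length R N = Module.length R M) : N = ⊤ := by
  obtain ⟨_, _⟩ := isFiniteLength_iff_isNoetherian_isArtinian.mp (Module.length_ne_top_iff.mp hM)
  by_contra hne
  exact (Submodule.length_lt hne).ne h

end Bookkeeping

/-! ### §1 Cyclic modules and `ϖ`-torsion over a discrete valuation ring -/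

section DVR

variable {R : Type u} [CommRing R] [IsDomain R] [IsDiscreteValuationRing R] {ϖ : R}
variable {N : Type v} [AddCommGroup N] [Module R N]
variable {P : Type w} [AddCommGroup P] [Module R P]

/-- `ℓ_R(R/(ϖⁿ)) = n` for a uniformiser `ϖ` (Mathlib's `Ring.ord`). [cite: Kaplansky1954, §11 (PDF p. 29)] -/
theorem length_quotient_uniformizer_pow (hϖ : Irreducible ϖ) (n : ℕ) :
    Module.length R (R ⧸ Ideal.span {ϖ ^ n}) = n := by
  change Ring.ord R (ϖ ^ n) = n
  rw [Ring.ord_pow (mem_nonZeroDivisors_of_ne_zero hϖ.ne_zero), Ring.ord_of_irreducible hϖ]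
  simp

omit [IsDomain R] [IsDiscreteValuationRing R] in
/-- `ϖᵏ` kills `R/(ϖᵏ)`. [cite: Kaplansky1954, §11 (PDF p. 29)] -/
theorem uniformizer_pow_smul_quotient_eq_zero (k : ℕ) (y : R ⧸ Ideal.span {ϖ ^ k}) : ϖ ^ k • y = 0 := by
  obtain ⟨r, rfl⟩ := Submodule.Quotient.mk_surjective _ y
  rw [← Submodule.Quotient.mk_smul, Submodule.Quotient.mk_eq_zero, smul_eq_mul]
  exact Ideal.mul_mem_right _ _ (Ideal.mem_span_singleton_self _)

omit [IsDomain R] [IsDiscreteValuationRing R] in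
/-- `ϖᵏ` kills any module isomorphic to `(R/(ϖᵏ))^ι`. [cite: Kaplansky1954, §11 (PDF p. 29)] -/
theorem uniformizer_pow_smul_eq_zero_of_linearEquiv {k : ℕ} {ι : Type*}
    (eN : N ≃ₗ[R] (ι → R ⧸ Ideal.span {ϖ ^ k})) (n : N) : ϖ ^ k • n = 0 := by
  apply eN.injective
  rw [map_smul, map_zero]
  funext i
  rw [Pi.smul_apply, Pi.zero_apply]
  exact uniformizer_pow_smul_quotient_eq_zero k _

/-- **The `ϖ`-torsion of a cyclic module is cyclic**: in `R ∙ x` (any `R`-module, `R` a DVR with uniformiser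
`ϖ`), if `ϖp = ϖq = 0` and `p ≠ 0` then `q ∈ Rp`. (Write `p = uϖᵐx`, `q = u'ϖ^{m'}x` with units `u, u'`;
`m' < m` would force `p = 0`.) [cite: Kaplansky1954, §11 (PDF p. 29)] -/
theorem span_singleton_uniformizer_torsion_cyclic (hϖ : Irreducible ϖ) (x : N)
    (p q : ↥(R ∙ x)) (hp : ϖ • p = 0) (hq : ϖ • q = 0) (hp0 : p ≠ 0) : ∃ r : R, q = r • p := by
  obtain ⟨a, ha⟩ := mem_span_singleton.mp p.2
  obtain ⟨b, hb⟩ := mem_span_singleton.mp q.2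
  have ha0 : a ≠ 0 := by
    rintro rfl
    apply hp0
    ext
    rw [← ha, zero_smul, Submodule.coe_zero]
  obtain ⟨m, u, rfl⟩ := IsDiscreteValuationRing.eq_unit_mul_pow_irreducible ha0 hϖ
  by_cases hb0 : b = 0
  · refine ⟨0, ?_⟩
    ext
    rw [← hb, hb0, zero_smul, zero_smul, Submodule.coe_zero]
  obtain ⟨m', u', rfl⟩ := IsDiscreteValuationRing.eq_unit_mul_pow_irreducible hb0 hϖ
  -- `ϖ^{m+1} x = 0` and `ϖ^{m'+1} x = 0`
  have key : ∀ (w : Rˣ) (e : ℕ) (y : ↥(R ∙ x)), ((w : R) * ϖ ^ e) • x = (y : N) → ϖ • y = 0 →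
      ϖ ^ (e + 1) • x = 0 := by
    intro w e y hy hy0
    have h1 : (ϖ • y : ↥(R ∙ x)) = 0 := hy0
    have h2 : ϖ • (y : N) = 0 := by
      have := congrArg Subtype.val h1
      simpa using this
    rw [← hy, smul_smul] at h2
    have h3 : (w : R) • ϖ ^ (e + 1) • x = 0 := by
      rw [smul_smul]
      convert h2 using 2
      ring
    rw [← Units.smul_def] at h3
    exact (smul_eq_zero_iff_eq w).mp h3
  have hpx := key u m p ha hp
  have hqx := key u' m' q hb hq
  by_cases hmm : m ≤ m'
  · refine ⟨(u' : R) * ϖ ^ (m' - m) * ↑u⁻¹, ?_⟩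
    ext
    rw [Submodule.coe_smul, ← ha, ← hb, smul_smul]
    congr 1
    calc (u' : R) * ϖ ^ m' = (u' : R) * (ϖ ^ (m' - m) * ϖ ^ m) := by rw [pow_sub_mul_pow ϖ hmm]
      _ = (u' : R) * ϖ ^ (m' - m) * (↑u⁻¹ * ↑u) * ϖ ^ m := by rw [Units.inv_mul]; ring
      _ = (u' : R) * ϖ ^ (m' - m) * ↑u⁻¹ * (↑u * ϖ ^ m) := by ring
  · exfalso
    apply hp0
    push Not at hmm
    ext
    rw [← ha, Submodule.coe_zero]
    have hle : m' + 1 ≤ m := hmm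
    calc ((u : R) * ϖ ^ m) • x = ((u : R) * ϖ ^ (m - (m' + 1))) • (ϖ ^ (m' + 1) • x) := by
          rw [smul_smul, mul_assoc, pow_sub_mul_pow ϖ hle]
      _ = 0 := by rw [hqx, smul_zero]

/-- `ℓ(P[ϖ]) ≤ 1` when the `ϖ`-torsion of `P` is cyclic (then `P[ϖ] = Rp ≅ R/(ϖ)` or `0`).
[cite: Kaplansky1954, §11 (PDF p. 29)] -/
theorem length_torsionBy_le_one (hϖ : Irreducible ϖ)
    (hP : ∀ p q : P, ϖ • p = 0 → ϖ • q = 0 → p ≠ 0 → ∃ r : R, q = r • p) :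
    Module.length R (torsionBy R P ϖ) ≤ 1 := by
  by_cases h0 : torsionBy R P ϖ = ⊥
  · rw [h0, Module.length_bot]
    exact zero_le
  obtain ⟨p, hpT, hp0⟩ := (Submodule.ne_bot_iff _).mp h0
  have hpϖ : ϖ • p = 0 := (mem_torsionBy_iff _ _).mp hpT
  have heq : torsionBy R P ϖ = R ∙ p := by
    refine le_antisymm (fun q hq => ?_) ((span_singleton_le_iff_mem _ _).mpr hpT)
    obtain ⟨r, rfl⟩ := hP p q hpϖ ((mem_torsionBy_iff _ _).mp hq) hp0
    exact mem_span_singleton.mpr ⟨r, rfl⟩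
  have htors : Ideal.torsionOf R P p = Ideal.span {ϖ} := by
    have hmax : (Ideal.span {ϖ}).IsMaximal := PrincipalIdealRing.isMaximal_of_irreducible hϖ
    refine (hmax.eq_of_le ?_ ?_).symm
    · rw [Ne, Ideal.eq_top_iff_one, Ideal.mem_torsionOf_iff, one_smul]
      exact hp0
    · intro r hr
      obtain ⟨s, rfl⟩ := Ideal.mem_span_singleton'.mp hr
      rw [Ideal.mem_torsionOf_iff, mul_smul, hpϖ, smul_zero]
  rw [(LinearEquiv.ofEq _ _ heq).length_eq, ← (Ideal.quotTorsionOfEquivSpanSingleton R P p).length_eq,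
    htors]
  have := length_quotient_uniformizer_pow hϖ 1
  rw [pow_one] at this
  rw [this]
  exact le_rfl

/-- `ℓ(P[ϖⁿ]) ≤ n` when the `ϖ`-torsion of `P` is cyclic (induction along `P[ϖ^{n+1}] → P[ϖ]`, `p ↦ ϖⁿp`,
with kernel `P[ϖⁿ]`). [cite: Kaplansky1954, §11 (PDF p. 29)] -/
theorem length_torsionBy_pow_le (hϖ : Irreducible ϖ)
    (hP : ∀ p q : P, ϖ • p = 0 → ϖ • q = 0 → p ≠ 0 → ∃ r : R, q = r • p) (n : ℕ) :
    Module.length R (torsionBy R P (ϖ ^ n)) ≤ n := by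
  induction n with
  | zero =>
    have : torsionBy R P (ϖ ^ 0) = ⊥ := by
      rw [pow_zero, eq_bot_iff]
      intro p hp
      rw [mem_torsionBy_iff, one_smul] at hp
      exact hp
    rw [this, Module.length_bot]
    exact le_rfl
  | succ n ih =>
    let ψ : ↥(torsionBy R P (ϖ ^ (n + 1))) →ₗ[R] ↥(torsionBy R P ϖ) :=
      { toFun := fun p => ⟨ϖ ^ n • (p : P), by
          rw [mem_torsionBy_iff, smul_smul, ← pow_succ']
          exact (mem_torsionBy_iff _ _).mp p.2⟩
        map_add' := fun p q => by
          ext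
          simp [smul_add]
        map_smul' := fun r p => by
          ext
          simp [smul_comm (ϖ ^ n) r] }
    have hker : Module.length R (LinearMap.ker ψ) ≤ n := by
      let ι : ↥(LinearMap.ker ψ) →ₗ[R] ↥(torsionBy R P (ϖ ^ n)) :=
        { toFun := fun p => ⟨((p : ↥(torsionBy R P (ϖ ^ (n + 1)))) : P), by
            rw [mem_torsionBy_iff]
            have h := p.2
            rw [LinearMap.mem_ker] at h
            exact congrArg Subtype.val h⟩
          map_add' := fun _ _ => rfl
          map_smul' := fun _ _ => rfl }
      have hι : Function.Injective ι := by
        intro p q h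
        have h' : ((p : ↥(torsionBy R P (ϖ ^ (n + 1)))) : P) = ((q : ↥(torsionBy R P (ϖ ^ (n + 1)))) : P) :=
          congrArg (fun z : ↥(torsionBy R P (ϖ ^ n)) => (z : P)) h
        exact Subtype.ext (Subtype.ext h')
      exact (Module.length_le_of_injective ι hι).trans ih
    have hrange : Module.length R (LinearMap.range ψ) ≤ 1 :=
      (Module.length_le_of_injective (LinearMap.range ψ).subtype (injective_subtype _)).trans
        (length_torsionBy_le_one hϖ hP)
    have hex : Function.Exact (LinearMap.ker ψ).subtype ψ.rangeRestrict :=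
      LinearMap.exact_iff.mpr (by rw [LinearMap.ker_rangeRestrict, Submodule.range_subtype])
    rw [Module.length_eq_add_of_exact (LinearMap.ker ψ).subtype ψ.rangeRestrict (injective_subtype _)
        ψ.surjective_rangeRestrict hex]
    calc Module.length R ↥(LinearMap.ker ψ) + Module.length R ↥(LinearMap.range ψ)
        ≤ (n : ℕ∞) + 1 := add_le_add hker hrange
      _ = ((n + 1 : ℕ) : ℕ∞) := by norm_cast

/-- **`ℓ(Hom_R(X, P)) ≤ ℓ(X)`** for `X` finitely generated with `ϖᵏX = 0` and `P` with cyclic `ϖ`-torsion: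
`X ≅ Π R/(ϖ^{nᵢ})`, `Hom(R/(ϖⁿ), P) ≅ P[ϖⁿ]` and `ℓ(P[ϖⁿ]) ≤ n`. (Equality holds when `P ⊇ R/(ϖᵏ)`,
Matlis duality; only the inequality is needed.) [cite: Fuchs1970, §43 Example 2 and Theorem 43.1 (PDF pp. 177–179)] -/
theorem length_linearMap_le (hϖ : Irreducible ϖ) {X : Type*} [AddCommGroup X] [Module R X]
    [Module.Finite R X] {k : ℕ} (hX : ∀ x : X, ϖ ^ k • x = 0)
    (hP : ∀ p q : P, ϖ • p = 0 → ϖ • q = 0 → p ≠ 0 → ∃ r : R, q = r • p) :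
    Module.length R (X →ₗ[R] P) ≤ Module.length R X := by
  classical
  have hXt : Module.IsTorsion R X := fun x =>
    ⟨⟨ϖ ^ k, mem_nonZeroDivisors_of_ne_zero (pow_ne_zero _ hϖ.ne_zero)⟩, hX x⟩
  obtain ⟨s, n, -, -, ⟨e⟩⟩ := exists_linearEquiv_pi_quotient_uniformizer_pow_of_isTorsion hϖ X hXt
  let e1 : (X →ₗ[R] P) ≃ₗ[R] ((Π i : Fin s, R ⧸ Ideal.span {ϖ ^ n i}) →ₗ[R] P) :=
    LinearEquiv.congrLeft P R e
  let e2 : ((Π i : Fin s, R ⧸ Ideal.span {ϖ ^ n i}) →ₗ[R] P) ≃ₗ[R]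
      (Π i : Fin s, (R ⧸ Ideal.span {ϖ ^ n i}) →ₗ[R] P) :=
    (LinearMap.lsum R (fun i : Fin s => R ⧸ Ideal.span {ϖ ^ n i}) R).symm
  rw [e1.length_eq, e2.length_eq, Module.length_pi_of_fintype, e.length_eq, Module.length_pi_of_fintype]
  refine Finset.sum_le_sum fun i _ => ?_
  obtain ⟨e3, -⟩ := HomModules.exists_linearEquiv_torsionBy (C := P) (ϖ ^ n i)
  rw [e3.length_eq, length_quotient_uniformizer_pow hϖ]
  exact length_torsionBy_pow_le hϖ hP (n i)

/-- **`P` cogenerates the `ϖᵏ`-torsion modules** when it contains an element `p₀` of exact order `ϖᵏ`: for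
`X` finitely generated with `ϖᵏX = 0` and `x ≠ 0` there is `φ : X → P` with `φ(x) ≠ 0` (`X ≅ Π R/(ϖ^{nᵢ})`,
`nᵢ ≤ k`, and `R/(ϖⁿ) ↪ P`, `1 ↦ ϖ^{k−n}p₀`). [cite: Fuchs1970, §43 Example 2 (PDF p. 177)] -/
theorem exists_linearMap_apply_ne_zero (hϖ : Irreducible ϖ) {X : Type*} [AddCommGroup X] [Module R X]
    [Module.Finite R X] {k : ℕ} (hX : ∀ x : X, ϖ ^ k • x = 0)
    {p₀ : P} (hp₀ : ϖ ^ k • p₀ = 0) (hp₀' : ∀ r : R, r • p₀ = 0 → ϖ ^ k ∣ r) {x : X} (hx : x ≠ 0) :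
    ∃ φ : X →ₗ[R] P, φ x ≠ 0 := by
  classical
  have hXt : Module.IsTorsion R X := fun x =>
    ⟨⟨ϖ ^ k, mem_nonZeroDivisors_of_ne_zero (pow_ne_zero _ hϖ.ne_zero)⟩, hX x⟩
  obtain ⟨s, n, -, -, ⟨e⟩⟩ := exists_linearEquiv_pi_quotient_uniformizer_pow_of_isTorsion hϖ X hXt
  have hex : e x ≠ 0 := by simpa using hx
  obtain ⟨i, hi⟩ : ∃ i, e x i ≠ 0 := by
    by_contra h
    push Not at h
    exact hex (funext h)
  -- `n i ≤ k`
  have hni : n i ≤ k := by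
    have h1 : ϖ ^ k • (Pi.single i 1 : Π j : Fin s, R ⧸ Ideal.span {ϖ ^ n j}) = 0 := by
      have := congrArg e (hX (e.symm (Pi.single i 1)))
      rwa [map_smul, map_zero, LinearEquiv.apply_symm_apply] at this
    have h2 : (Ideal.Quotient.mk (Ideal.span {ϖ ^ n i}) (ϖ ^ k)) = 0 := by
      have := congrFun h1 i
      rw [Pi.smul_apply, Pi.single_eq_same, Pi.zero_apply, Algebra.smul_def, mul_one,
        Ideal.Quotient.algebraMap_eq] at this
      exact this
    rw [Ideal.Quotient.eq_zero_iff_mem, Ideal.mem_span_singleton] at h2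
    exact (pow_dvd_pow_iff hϖ.ne_zero hϖ.not_isUnit).mp h2
  have hle : (Ideal.span {ϖ ^ n i} : Submodule R R) ≤
      LinearMap.ker (LinearMap.toSpanSingleton R P (ϖ ^ (k - n i) • p₀)) := by
    intro r hr
    obtain ⟨a, rfl⟩ := Ideal.mem_span_singleton'.mp hr
    rw [LinearMap.mem_ker, LinearMap.toSpanSingleton_apply, smul_smul, mul_assoc,
      mul_comm (ϖ ^ n i), pow_sub_mul_pow ϖ hni, mul_smul, hp₀, smul_zero]
  let χ : (R ⧸ Ideal.span {ϖ ^ n i}) →ₗ[R] P := (Ideal.span {ϖ ^ n i}).liftQ _ hle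
  refine ⟨χ ∘ₗ (LinearMap.proj i) ∘ₗ (e : X →ₗ[R] Π j : Fin s, R ⧸ Ideal.span {ϖ ^ n j}),
    fun h => hi ?_⟩
  obtain ⟨r, hr⟩ := Ideal.Quotient.mk_surjective (e x i)
  have hχ : χ (e x i) = (r * ϖ ^ (k - n i)) • p₀ := by
    rw [← hr, mul_smul]
    exact Submodule.liftQ_apply _ _ r
  have h' : (r * ϖ ^ (k - n i)) • p₀ = 0 := by
    rw [← hχ]
    simpa using h
  obtain ⟨c, hc⟩ := hp₀' _ h'
  rw [← hr, Ideal.Quotient.eq_zero_iff_mem, Ideal.mem_span_singleton]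
  refine ⟨c, mul_right_cancel₀ (pow_ne_zero (k - n i) hϖ.ne_zero) ?_⟩
  rw [hc, ← pow_sub_mul_pow ϖ hni]
  ring

end DVR

end Literature.Algebra.Module
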